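import Summits.Parity.GeneralizedHardyLittlewood.Theorems.LiouvilleShiftedTablesSieveToMAvgTupleFacts

/-!
# Sieve glue for `SieveToMAvg`, part 9b: uniform per-tuple bounds — the Type-II case

Support file for item stmt-Parity-14274 (route `LiouvilleShiftedTables`).  The uniform majorants
`BII` (Type-II tuples) and `BI2` (the other tuples) of `TT(prodB κ)` at a dyadic scale `x`, and the
Type-II case: a relevant tuple with a window `(2x)^{a'} ≤ ∏_{i∈S} P_i ≤ (2x)^{b'}` has
`TT(prodB κ) ≤ BII + sliver_κ` (part 8a plus the uniform divisor power sum bound of part 9a).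
-/

namespace Summit.Parity.GeneralizedHardyLittlewood.Theorems.SieveToMAvg

open Finset Real
open scoped ArithmeticFunction.zeta ArithmeticFunction.sigma
open Literature.NumberTheory.Sieve.BFI

/-- `ℓ = 1 + log(2^{2j} · 2x)`, a common majorant of `1 + log Y` for the supports met at scale `x`. [folklore] -/
noncomputable def ell2 (j : ℕ) (x : ℝ) : ℝ := 1 + Real.log (2 ^ (2 * j) * (2 * x))

/-- The Type-II factor `W = (X²/(log X)^C)^{1/4} H_Q^{3/4}`. [folklore] -/
noncomputable def Wfac (X C : ℝ) (Q : ℕ) : ℝ :=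
  (X ^ 2 / Real.log X ^ C) ^ ((1 : ℝ) / 4) * (∑ q ∈ Icc 1 Q, (q : ℝ)⁻¹) ^ ((3 : ℝ) / 4)

/-- The uniform Type-II majorant `BII = √K_f · Cτ 2^j √(2x) ℓ^e · W`. [folklore] -/
noncomputable def BII (j : ℕ) (x X C Cτ : ℝ) (e Kf Q : ℕ) : ℝ :=
  Real.sqrt Kf * (Cτ * 2 ^ j * Real.sqrt (2 * x) * ell2 j x ^ e) * Wfac X C Q

/-- The uniform Type-I₂ majorant
`BI2 = 4K_f√K_f √(2x H_Q H_{2x} Dτ'(4j,2x) + Q · 2Cτ ℓ^e 2^{2j} (2x)^{1−b'}) √(C₂X/(log X)^A)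
      + 12 Δ H_Q Cτ ℓ^e 2^{2j} x + Cτ ℓ^e 2^{2j} (2x)^{1−b'} (2H_Q + 2Q)`. [folklore] -/
noncomputable def BI2 (j : ℕ) (x X Δ A C₂ Cτ b' : ℝ) (e Kf Q : ℕ) : ℝ :=
  4 * Kf * Real.sqrt Kf *
    Real.sqrt (2 * x * Hsum Q * Hsum (2 * x) * Dtau' (4 * j) (2 * x) +
      Q * (2 * Cτ * ell2 j x ^ e * 2 ^ (2 * j) * (2 * x) ^ (1 - b'))) * Real.sqrt (C₂ * X / Real.log X ^ A) +
  (12 * Δ * Hsum Q * Cτ * ell2 j x ^ e * 2 ^ (2 * j) * x +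
    Cτ * ell2 j x ^ e * 2 ^ (2 * j) * (2 * x) ^ (1 - b') * (2 * Hsum Q + 2 * Q))

section Nonneg

/-- `ℓ ≥ 1` for `x ≥ 1/2`. [folklore] -/
theorem one_le_ell2 (j : ℕ) {x : ℝ} (hx : 1 / 2 ≤ x) : 1 ≤ ell2 j x := by
  unfold ell2
  have : (1 : ℝ) ≤ 2 ^ (2 * j) * (2 * x) := by
    have h1 : (1 : ℝ) ≤ 2 ^ (2 * j) := one_le_pow₀ (by norm_num)
    nlinarith
  linarith [Real.log_nonneg this]

/-- `W ≥ 0` for `X ≥ 1`. [folklore] -/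
theorem Wfac_nonneg {X : ℝ} (hX : 1 ≤ X) (C : ℝ) (Q : ℕ) : 0 ≤ Wfac X C Q := by
  unfold Wfac
  have h1 : 0 ≤ X ^ 2 / Real.log X ^ C :=
    div_nonneg (pow_nonneg (by linarith) 2) (Real.rpow_nonneg (Real.log_nonneg hX) C)
  have h2 : 0 ≤ ∑ q ∈ Icc 1 Q, (q : ℝ)⁻¹ := Finset.sum_nonneg fun q _ => by positivity
  positivity

/-- `BII ≥ 0`. [folklore] -/
theorem BII_nonneg (j : ℕ) {x X C Cτ : ℝ} (hx : 1 / 2 ≤ x) (hX : 1 ≤ X) (hC : 0 ≤ Cτ) (e Kf Q : ℕ) :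
    0 ≤ BII j x X C Cτ e Kf Q := by
  unfold BII
  have := one_le_ell2 j hx
  have := Wfac_nonneg hX C Q
  positivity

/-- `BI2 ≥ 0`. [folklore] -/
theorem BI2_nonneg (j : ℕ) {x X Δ A C₂ Cτ b' : ℝ} (hx : 1 / 2 ≤ x) (hΔ : 0 ≤ Δ) (hC : 0 ≤ Cτ)
    (e Kf Q : ℕ) : 0 ≤ BI2 j x X Δ A C₂ Cτ b' e Kf Q := by
  unfold BI2
  have := one_le_ell2 j hx
  have := Hsum_nonneg (Q : ℝ)
  have h2x : 0 ≤ (2 * x) ^ (1 - b') := Real.rpow_nonneg (by linarith) _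
  positivity

end Nonneg

section CaseII

variable {x : ℝ} {U j t : ℕ}

/-- `1 ≤ 2^{#T} ∏_{i∈T} P_i` when every `P_i ≥ 1/2`. [folklore] -/
theorem one_le_two_pow_mul_prod (κ : Fin (2 * j) → ℕ) (hP : ∀ i, 1 / 2 ≤ P x (κ i))
    (T : Finset (Fin (2 * j))) : 1 ≤ 2 ^ T.card * ∏ i ∈ T, P x (κ i) := by
  classical
  induction T using Finset.induction_on with
  | empty => simp
  | @insert a s ha ih =>
    rw [Finset.prod_insert ha, Finset.card_insert_of_notMem ha, pow_succ]
    have h1 := hP a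
    have h2 : 0 ≤ ∏ i ∈ s, P x (κ i) := Finset.prod_nonneg fun i _ => by linarith [hP i]
    calc (1 : ℝ) ≤ 1 * 1 := by norm_num
      _ ≤ (2 * P x (κ a)) * (2 ^ s.card * ∏ i ∈ s, P x (κ i)) :=
          mul_le_mul (by linarith) ih zero_le_one (by linarith)
      _ = 2 ^ s.card * 2 * (P x (κ a) * ∏ i ∈ s, P x (κ i)) := by ring

variable {h : ℕ} {X Δ δ C Cτ : ℝ} {e : ℕ}

/-- **The Type-II case.**  Under `HypII X (−h) δ C` and the uniform divisor bound
`Dτ(4j, Y) ≤ Cτ Y (1+log Y)^e` (`Y ≥ 1`), a tuple with all `P_i ≥ 1/2`, `∏ P_i < 2x` and a set of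
slots `S` (`S, Sᶜ ≠ ∅`) with `(1+Δ)X^δ ≤ ∏_S P_i`, `2^{2j} ∏_S P_i ≤ min(X^{1/3+δ}, 2x)` has
`TT(prodB κ) ≤ BII + sliver_κ`. [folklore] -/
theorem TT_prodB_caseII (hyp : HypII X (-(h : ℤ)) δ C) (hX : 1 ≤ X) (hx : 1 ≤ x) (hxX : 2 * x ≤ X)
    (hΔ : 0 < Δ) (hΔ' : Δ ≤ 1 / 2) {Q : ℕ} (hQ : Q ≤ ⌊X ^ (δ / 2)⌋₊) (h2 : 2 ≤ X ^ δ)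
    {Kf : ℕ} (hKf : 2 * x < (1 + Δ) ^ Kf) (hCτ : 0 ≤ Cτ)
    (hD : ∀ Y : ℝ, 1 ≤ Y → Dtau (4 * j) Y ≤ Cτ * Y * (1 + Real.log Y) ^ e)
    (κ : Fin (2 * j) → ℕ) (hP : ∀ i, 1 / 2 ≤ P x (κ i)) (hprod : ∏ i, P x (κ i) < 2 * x)
    {S : Finset (Fin (2 * j))} (hS : S.Nonempty) (hSc : Sᶜ.Nonempty)
    (hA₁ : (1 + Δ) * X ^ δ ≤ ∏ i ∈ S, P x (κ i)) (hA₂ : 2 ^ (2 * j) * ∏ i ∈ S, P x (κ i) ≤ X ^ (1 / 3 + δ))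
    (hA₂x : 2 ^ (2 * j) * ∏ i ∈ S, P x (κ i) ≤ 2 * x) :
    TT (lamW h) h Q x (fun n => prodB x U j t κ n) ≤
      BII j x X C Cτ e Kf Q +
        ∑ q ∈ moduli Q h, ∑ n ∈ (dyadClass h q x).filter (fun n => Sliver x Δ n), absProd x U j t κ n := by
  have hx0 : 0 < x := by linarith
  have hcardS : S.card ≤ 2 * j := by
    have := Finset.card_le_univ S; rwa [Fintype.card_fin] at this
  have hpS : 0 < ∏ i ∈ S, P x (κ i) := Finset.prod_pos fun i _ => P_pos hx0 (κ i)
  have hpow_le : (2 : ℝ) ^ S.card ≤ 2 ^ (2 * j) := pow_le_pow_right₀ (by norm_num) hcardS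
  have hA₂' : 2 ^ S.card * ∏ i ∈ S, P x (κ i) ≤ X ^ (1 / 3 + δ) :=
    (mul_le_mul_of_nonneg_right hpow_le hpS.le).trans hA₂
  have hA₂x' : 2 ^ S.card * ∏ i ∈ S, P x (κ i) ≤ 2 * x :=
    (mul_le_mul_of_nonneg_right hpow_le hpS.le).trans hA₂x
  have hmain := TT_prodB_le_typeII (U := U) (t := t) hyp hX hx0 hxX hΔ hΔ' hQ h2 hKf κ hS hSc hA₁ hA₂' hA₂x'
  refine hmain.trans (add_le_add ?_ le_rfl)
  -- the two divisor sums
  set Y₁ := 2 ^ S.card * ∏ i ∈ S, P x (κ i) with hY₁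
  set Y₂ := 2 ^ Sᶜ.card * ∏ i ∈ Sᶜ, P x (κ i) with hY₂
  have hY₁1 : 1 ≤ Y₁ := one_le_two_pow_mul_prod κ hP S
  have hY₂1 : 1 ≤ Y₂ := one_le_two_pow_mul_prod κ hP Sᶜ
  have hY12 : Y₁ * Y₂ = 2 ^ (2 * j) * ∏ i, P x (κ i) := by
    have hcard : S.card + Sᶜ.card = 2 * j := by
      rw [Finset.card_compl, Fintype.card_fin]; omega
    have hpow : (2 : ℝ) ^ (2 * j) = 2 ^ S.card * 2 ^ Sᶜ.card := by rw [← pow_add, hcard]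
    rw [hY₁, hY₂, ← Finset.prod_mul_prod_compl S (fun i => P x (κ i)), hpow]; ring
  have hZ : Y₁ * Y₂ ≤ 2 ^ (2 * j) * (2 * x) := by
    rw [hY12]; exact mul_le_mul_of_nonneg_left hprod.le (by positivity)
  have hY₁Z : Y₁ ≤ 2 ^ (2 * j) * (2 * x) := le_trans (le_mul_of_one_le_right (by linarith) hY₂1) hZ
  have hY₂Z : Y₂ ≤ 2 ^ (2 * j) * (2 * x) := le_trans (le_mul_of_one_le_left (by linarith) hY₁1) hZ
  have hD₁ : Dtau (4 * j) Y₁ ≤ Cτ * Y₁ * ell2 j x ^ e :=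
    (hD Y₁ hY₁1).trans (majorant_mono hCτ hY₁1 hY₁Z e)
  have hD₂ : Dtau (4 * j) Y₂ ≤ Cτ * Y₂ * ell2 j x ^ e :=
    (hD Y₂ hY₂1).trans (majorant_mono hCτ hY₂1 hY₂Z e)
  have hℓ : 1 ≤ ell2 j x := one_le_ell2 j (by linarith)
  -- `√Dτ(Y₁) √Dτ(Y₂) ≤ Cτ ℓ^e 2^j √(2x)`
  have hsq : Real.sqrt (Dtau (4 * j) Y₁) * Real.sqrt (Dtau (4 * j) Y₂) ≤ Cτ * 2 ^ j * Real.sqrt (2 * x) * ell2 j x ^ e := by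
    rw [← Real.sqrt_mul (Dtau_nonneg _ _)]
    have hle : Dtau (4 * j) Y₁ * Dtau (4 * j) Y₂ ≤ (Cτ * ell2 j x ^ e) ^ 2 * (2 ^ (2 * j) * (2 * x)) := by
      calc Dtau (4 * j) Y₁ * Dtau (4 * j) Y₂ ≤ (Cτ * Y₁ * ell2 j x ^ e) * (Cτ * Y₂ * ell2 j x ^ e) :=
            mul_le_mul hD₁ hD₂ (Dtau_nonneg _ _) (by positivity)
        _ = (Cτ * ell2 j x ^ e) ^ 2 * (Y₁ * Y₂) := by ring
        _ ≤ (Cτ * ell2 j x ^ e) ^ 2 * (2 ^ (2 * j) * (2 * x)) := mul_le_mul_of_nonneg_left hZ (by positivity)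
    refine (Real.sqrt_le_sqrt hle).trans (le_of_eq ?_)
    rw [Real.sqrt_mul (by positivity), Real.sqrt_sq (by positivity), Real.sqrt_mul (by positivity),
      show ((2 : ℝ) ^ (2 * j)) = (2 ^ j) ^ 2 by rw [← pow_mul, mul_comm], Real.sqrt_sq (by positivity)]
    ring
  unfold BII Wfac
  have hW := Wfac_nonneg hX C Q
  unfold Wfac at hW
  calc Real.sqrt Kf * Real.sqrt (Dtau (4 * j) Y₁) * Real.sqrt (Dtau (4 * j) Y₂) *
        ((X ^ 2 / Real.log X ^ C) ^ ((1 : ℝ) / 4) * (∑ q ∈ Icc 1 Q, (q : ℝ)⁻¹) ^ ((3 : ℝ) / 4))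
      = Real.sqrt Kf * (Real.sqrt (Dtau (4 * j) Y₁) * Real.sqrt (Dtau (4 * j) Y₂)) *
        ((X ^ 2 / Real.log X ^ C) ^ ((1 : ℝ) / 4) * (∑ q ∈ Icc 1 Q, (q : ℝ)⁻¹) ^ ((3 : ℝ) / 4)) := by ring
    _ ≤ Real.sqrt Kf * (Cτ * 2 ^ j * Real.sqrt (2 * x) * ell2 j x ^ e) *
        ((X ^ 2 / Real.log X ^ C) ^ ((1 : ℝ) / 4) * (∑ q ∈ Icc 1 Q, (q : ℝ)⁻¹) ^ ((3 : ℝ) / 4)) := by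
        gcongr

end CaseII

end Summit.Parity.GeneralizedHardyLittlewood.Theorems.SieveToMAvg
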